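import Literature.Computability.QuantumComplexity.EquatorialMoments
import Literature.Computability.Complexity.CoinCounting
import HarnessLib

/-!
# Chebyshev over independent coin blocks, and coin-string bookkeeping

Topic `Literature/Computability/QuantumComplexity`, sub-namespace `BravyiGosset`, fifth file
towards `BravyiGosset2016_estimateAcceptProb_holds`.

Bravyi–Gosset's norm estimation (2016, §II, eq. (15)–(16) and Lemma 2) averages `L = O(ε⁻²)`
independent samples `|⟨θ_i|ψ⟩|²` and invokes Chebyshev's inequality with the first two moments.
This file is that step in counting form, for a statistic `X : {0,1}^κ → ℝ` of one block of `κ`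
fair coins with `Σ_β X(β) = 2^κ μ` and `Σ_β X(β)² ≤ 2^κ · 2μ²` (the moments delivered by
`EquatorialMoments.lean`):

* `card_deviation_mul_sq_le` — for `ω ∈ ({0,1}^κ)^L` and `Y(ω) = Σ_i X(ω_i)`,
  `#{ω : δ ≤ |Y(ω) − Lμ|} · δ² ≤ L · 2^{κL} · μ²` (variance of a sum of independent blocks,
  `sum_sq_deviation_eq`, then Markov);
* `card_deviation_le_quarter` — with `L = 16 (q+1)²`, `δ = Lμ/(2(q+1))`, `μ > 0`:
  `4 · #{bad ω} ≤ 2^{κL}`;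
* the identification of the first `Lκ` coins of a coin string with `ω` (`blocksEquiv`,
  `blocksEquiv_apply`), and the enumeration of `𝔽₂^n` by the binary digits of `0, …, 2^n − 1`
  (`sum_range_two_pow_eq_sum_testBit`), which is how the machine of the sequel runs through the
  `2^{⌈t/2⌉}` terms.

## References

* S. Bravyi, D. Gosset, *Improved classical simulation of quantum circuits dominated by Clifford
  gates*, Phys. Rev. Lett. 116 (2016) 250501, arXiv:1601.07601v3, §II eq. (15)–(16), Lemma 2
  ("by Chebyshev's inequality … with probability at least 3/4 … choosing `L = 4ε⁻²`").
* S. Arora, B. Barak, *Computational Complexity: A Modern Approach*, CUP 2009, §7.4.1 and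
  Lemma A.12 (Chebyshev), independent repetitions.
-/

noncomputable section

namespace Literature.Computability.QuantumComplexity.BravyiGosset

open Finset

/-! ### Sums over product sample spaces -/

section Blocks

variable {B : Type*} [Fintype B]

/-- **Independence of distinct coordinates**: for `i ≠ j`,
`Σ_{ω} f(ω_i) g(ω_j) = |B|^{L−2} (Σ f)(Σ g)`; here in the form needed: if `Σ f = 0` the sum
vanishes. [cite: AroraBarak2009, §7.4.1 (independent repetitions)] -/
theorem sum_mul_apply_ne_eq_zero {L : ℕ} (f g : B → ℝ) (hf : ∑ b, f b = 0) {i j : Fin L} (hij : i ≠ j) :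
    ∑ ω : Fin L → B, f (ω i) * g (ω j) = 0 := by
  classical
  set F : Fin L → B → ℝ := fun l b => if l = i then f b else if l = j then g b else 1 with hF
  have hprod : ∀ ω : Fin L → B, f (ω i) * g (ω j) = ∏ l, F l (ω l) := by
    intro ω
    rw [← Finset.mul_prod_erase _ _ (Finset.mem_univ i), ← Finset.mul_prod_erase _ _
      (Finset.mem_erase.2 ⟨Ne.symm hij, Finset.mem_univ j⟩), Finset.prod_eq_one]
    · simp [hF, Ne.symm hij]
    · intro l hl
      have h1 : l ≠ j := Finset.ne_of_mem_erase hl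
      have h2 : l ≠ i := Finset.ne_of_mem_erase (Finset.mem_of_mem_erase hl)
      simp [hF, h1, h2]
  simp only [hprod]
  rw [← Fintype.piFinset_univ, ← Finset.prod_univ_sum (fun _ => (Finset.univ : Finset B)) F]
  apply Finset.prod_eq_zero (Finset.mem_univ i)
  simp [hF, hf]

/-- **One coordinate**: `Σ_{ω} f(ω_i) = |B|^{L−1} Σ f`. [folklore] -/
theorem sum_apply_eq {L : ℕ} (f : B → ℝ) (i : Fin L) :
    ∑ ω : Fin L → B, f (ω i) = (Fintype.card B : ℝ) ^ (L - 1) * ∑ b, f b := by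
  classical
  set F : Fin L → B → ℝ := fun l b => if l = i then f b else 1 with hF
  have hprod : ∀ ω : Fin L → B, f (ω i) = ∏ l, F l (ω l) := by
    intro ω
    rw [← Finset.mul_prod_erase _ _ (Finset.mem_univ i), Finset.prod_eq_one]
    · simp [hF]
    · intro l hl
      simp [hF, Finset.ne_of_mem_erase hl]
  simp only [hprod]
  rw [← Fintype.piFinset_univ, ← Finset.prod_univ_sum (fun _ => (Finset.univ : Finset B)) F,
    ← Finset.mul_prod_erase _ _ (Finset.mem_univ i)]
  have hrest : ∏ l ∈ Finset.univ.erase i, ∑ b, F l b = (Fintype.card B : ℝ) ^ (L - 1) := by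
    rw [Finset.prod_congr rfl fun l hl => by
      rw [show (∑ b, F l b) = Fintype.card B from by simp [hF, Finset.ne_of_mem_erase hl]]]
    rw [Finset.prod_const, Finset.card_erase_of_mem (Finset.mem_univ i), Finset.card_univ,
      Fintype.card_fin]
  rw [hrest]
  simp [hF, mul_comm]

/-- **Variance of a sum of independent blocks**: if `Σ_b D(b) = 0` then
`Σ_ω (Σ_i D(ω_i))² = L · |B|^{L−1} · Σ_b D(b)²`. [cite: AroraBarak2009, Lemma A.12 and §7.4.1] -/
theorem sum_sq_sum_apply {L : ℕ} (D : B → ℝ) (hD : ∑ b, D b = 0) :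
    ∑ ω : Fin L → B, (∑ i, D (ω i)) ^ 2 = L * (Fintype.card B : ℝ) ^ (L - 1) * ∑ b, D b ^ 2 := by
  have hexp : ∀ ω : Fin L → B, (∑ i, D (ω i)) ^ 2 = ∑ i, ∑ j, D (ω i) * D (ω j) := fun ω => by
    rw [pow_two, Finset.sum_mul_sum]
  simp only [hexp]
  rw [Finset.sum_comm]
  have hinner : ∀ i : Fin L, ∑ ω : Fin L → B, ∑ j, D (ω i) * D (ω j) =
      (Fintype.card B : ℝ) ^ (L - 1) * ∑ b, D b ^ 2 := by
    intro i
    rw [Finset.sum_comm, ← Finset.add_sum_erase _ _ (Finset.mem_univ i), Finset.sum_eq_zero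
      (s := Finset.univ.erase i) (fun j hj => sum_mul_apply_ne_eq_zero D D hD (Finset.ne_of_mem_erase hj).symm),
      add_zero]
    simp only [← pow_two]
    exact sum_apply_eq (fun b => D b ^ 2) i
  simp only [hinner, Finset.sum_const, Finset.card_univ, Fintype.card_fin, nsmul_eq_mul]
  ring

end Blocks

/-! ### Chebyshev in counting form -/

/-- The centred second moment from the two raw moments:
`Σ (X − μ)² = Σ X² − 2^κ μ² ≤ 2^κ μ²`. [folklore] -/
theorem sum_sq_sub_le {κ : ℕ} (X : (Fin κ → Bool) → ℝ) (μ : ℝ)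
    (hmean : ∑ β, X β = 2 ^ κ * μ) (hsq : ∑ β, X β ^ 2 ≤ 2 ^ κ * (2 * μ ^ 2)) :
    ∑ β, (X β - μ) ^ 2 ≤ 2 ^ κ * μ ^ 2 := by
  have hexp : ∑ β, (X β - μ) ^ 2 = ∑ β, X β ^ 2 - 2 * μ * ∑ β, X β + 2 ^ κ * μ ^ 2 := by
    simp only [sub_sq, Finset.sum_add_distrib, Finset.sum_sub_distrib, Finset.sum_const, Finset.card_univ,
      Fintype.card_fun, Fintype.card_bool, Fintype.card_fin, nsmul_eq_mul, Finset.mul_sum]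
    push_cast
    congr 1
    congr 1
    exact Finset.sum_congr rfl fun β _ => by ring
  rw [hexp, hmean]
  nlinarith

/-- **Chebyshev over independent coin blocks, counting form.** For a one-block statistic `X` with
`Σ_β X(β) = 2^κ μ` and `Σ_β X(β)² ≤ 2^κ · 2μ²`, the sum `Y(ω) = Σ_{i<L} X(ω_i)` over `L`
independent blocks deviates from `Lμ` by `δ` or more on at most `L 2^{κL} μ² / δ²` of the `2^{κL}`
block tuples: `#{ω : δ ≤ |Y(ω) − Lμ|} · δ² ≤ L · 2^{κL} · μ²`.
[cite: BravyiGosset2016, §II eq. (15)–(16)] -/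
theorem card_deviation_mul_sq_le {κ L : ℕ} (X : (Fin κ → Bool) → ℝ) (μ : ℝ)
    (hmean : ∑ β, X β = 2 ^ κ * μ) (hsq : ∑ β, X β ^ 2 ≤ 2 ^ κ * (2 * μ ^ 2)) (δ : ℝ) (hδ : 0 ≤ δ) :
    ((Finset.univ.filter fun ω : Fin L → (Fin κ → Bool) => δ ≤ |∑ i, X (ω i) - L * μ|).card : ℝ) * δ ^ 2 ≤
      L * 2 ^ (κ * L) * μ ^ 2 := by
  classical
  obtain ⟨D, hDdef⟩ : ∃ D : (Fin κ → Bool) → ℝ, D = fun β => X β - μ := ⟨_, rfl⟩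
  have hD : ∑ β, D β = 0 := by
    rw [hDdef]
    simp only [Finset.sum_sub_distrib, hmean, Finset.sum_const, Finset.card_univ, Fintype.card_fun,
      Fintype.card_bool, Fintype.card_fin, nsmul_eq_mul]
    push_cast; ring
  have hdev : ∀ ω : Fin L → (Fin κ → Bool), ∑ i, X (ω i) - L * μ = ∑ i, D (ω i) := by
    intro ω
    rw [hDdef]
    simp only [Finset.sum_sub_distrib, Finset.sum_const, Finset.card_univ, Fintype.card_fin, nsmul_eq_mul]
  set S := Finset.univ.filter fun ω : Fin L → (Fin κ → Bool) => δ ≤ |∑ i, X (ω i) - L * μ| with hS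
  -- Markov on the squares
  have h1 : (S.card : ℝ) * δ ^ 2 ≤ ∑ ω ∈ S, (∑ i, D (ω i)) ^ 2 := by
    rw [← nsmul_eq_mul, ← Finset.sum_const]
    refine Finset.sum_le_sum fun ω hω => ?_
    have h := (Finset.mem_filter.1 hω).2
    rw [hdev] at h
    calc δ ^ 2 ≤ |∑ i, D (ω i)| ^ 2 := pow_le_pow_left₀ hδ h 2
      _ = (∑ i, D (ω i)) ^ 2 := sq_abs _
  have h2 : ∑ ω ∈ S, (∑ i, D (ω i)) ^ 2 ≤ ∑ ω : Fin L → (Fin κ → Bool), (∑ i, D (ω i)) ^ 2 :=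
    Finset.sum_le_sum_of_subset_of_nonneg (Finset.filter_subset _ _) fun ω _ _ => sq_nonneg _
  refine h1.trans (h2.trans ?_)
  rw [sum_sq_sum_apply D hD, Fintype.card_fun, Fintype.card_bool, Fintype.card_fin]
  have hvar := sum_sq_sub_le X μ hmean hsq
  have hvar' : ∑ b, D b ^ 2 ≤ 2 ^ κ * μ ^ 2 := by rw [hDdef]; exact hvar
  push_cast
  rcases Nat.eq_zero_or_pos L with hL0 | hLpos
  · subst hL0; simp
  · have hpow : ((2 : ℝ) ^ κ) ^ (L - 1) * 2 ^ κ = 2 ^ (κ * L) := by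
      rw [← pow_succ, Nat.sub_add_cancel hLpos, ← pow_mul]
    calc (L : ℝ) * (2 ^ κ) ^ (L - 1) * ∑ b, D b ^ 2 ≤ L * (2 ^ κ) ^ (L - 1) * (2 ^ κ * μ ^ 2) :=
          mul_le_mul_of_nonneg_left hvar' (by positivity)
      _ = L * 2 ^ (κ * L) * μ ^ 2 := by rw [← hpow]; ring

/-- **The `3/4` rule.** With `L = 16 (q+1)²` samples, relative accuracy `ε/2 = 1/(2(q+1))` and
`μ > 0`, at most a quarter of the block tuples deviate:
`4 · #{ω : Lμ/(2(q+1)) ≤ |Y(ω) − Lμ|} ≤ 2^{κL}`.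
[cite: BravyiGosset2016, §II eq. (16) and Lemma 2 (`L = 4ε⁻²`, probability `≥ 3/4`)] -/
theorem card_deviation_le_quarter {κ : ℕ} (q : ℕ) (X : (Fin κ → Bool) → ℝ) (μ : ℝ) (hμ : 0 < μ)
    (hmean : ∑ β, X β = 2 ^ κ * μ) (hsq : ∑ β, X β ^ 2 ≤ 2 ^ κ * (2 * μ ^ 2)) :
    4 * ((Finset.univ.filter fun ω : Fin (16 * (q + 1) ^ 2) → (Fin κ → Bool) =>
        (16 * (q + 1) ^ 2 : ℕ) * μ / (2 * (q + 1)) ≤ |∑ i, X (ω i) - (16 * (q + 1) ^ 2 : ℕ) * μ|).card : ℝ) ≤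
      2 ^ (κ * (16 * (q + 1) ^ 2)) := by
  set L : ℕ := 16 * (q + 1) ^ 2 with hL
  have hq : (0 : ℝ) < q + 1 := by positivity
  have h := card_deviation_mul_sq_le (L := L) X μ hmean hsq ((L : ℝ) * μ / (2 * (q + 1))) (by positivity)
  have hLr : (L : ℝ) = 16 * (q + 1) ^ 2 := by rw [hL]; push_cast; ring
  have hδ : ((L : ℝ) * μ / (2 * (q + 1))) ^ 2 = (L : ℝ) * μ ^ 2 * 4 := by
    rw [div_pow, hLr]; field_simp; ring
  rw [hδ] at h
  have hpos : (0 : ℝ) < (L : ℝ) * μ ^ 2 := by rw [hLr]; positivity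
  nlinarith

/-! ### Coin strings and block tuples -/

/-- The first `L κ` coins of a string as an `L`-tuple of blocks: block `i`, position `q` is coin
`i κ + q`. [folklore] -/
def blocksOf (κ : ℕ) (r : List Bool) (L : ℕ) : Fin L → (Fin κ → Bool) :=
  fun i q => r.getD (i * κ + q) false

/-- **Coin strings of length `L κ` are block tuples**, bijectively. [folklore] -/
def blocksEquiv (κ L : ℕ) : List.Vector Bool (L * κ) ≃ (Fin L → (Fin κ → Bool)) :=
  (Equiv.vectorEquivFin Bool (L * κ)).trans
    ((finProdFinEquiv.symm.arrowCongr (Equiv.refl Bool)).trans (Equiv.curry _ _ _))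

/-- The bijection reads block `i`, position `q` at coin `i κ + q`. [folklore] -/
theorem blocksEquiv_apply (κ L : ℕ) (v : List.Vector Bool (L * κ)) :
    blocksEquiv κ L v = blocksOf κ v.toList L := by
  funext i q
  show v.get (finProdFinEquiv (i, q)) = v.toList.getD (i * κ + q) false
  have hidx : ((finProdFinEquiv (i, q) : Fin (L * κ)) : ℕ) = i * κ + q := by
    simp only [finProdFinEquiv, Equiv.coe_fn_mk]
    ring
  have hlt : (i : ℕ) * κ + q < v.toList.length := by
    rw [v.toList_length, ← hidx]; exact (finProdFinEquiv (i, q)).2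
  rw [List.Vector.get_eq_get_toList, List.getD_eq_getElem _ _ hlt]
  simp only [List.get_eq_getElem, Fin.val_cast, hidx]

/-- Counting through the bijection: the number of coin strings of length `L κ` whose block tuple
lies in a set is the number of such tuples. [folklore] -/
theorem cnt_blocks (κ L : ℕ) (P : (Fin L → (Fin κ → Bool)) → Prop) [DecidablePred P] :
    Complexity.cnt (L * κ) {r | P (blocksOf κ r L)} = (Finset.univ.filter P).card := by
  classical
  unfold Complexity.cnt
  rw [← Finset.card_map (blocksEquiv κ L).toEmbedding]
  congr 1
  ext ω
  simp only [Finset.mem_map_equiv, Finset.mem_filter, Finset.mem_univ, true_and, Set.mem_setOf_eq]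
  rw [← blocksEquiv_apply, Equiv.apply_symm_apply]

/-! ### Enumerating `𝔽₂^n` by binary digits -/

/-- **Binary counting enumerates the cube.** For a function of bit-readers that only looks at the
first `n` bits, summing it over the binary digits of `0, …, 2^n − 1` is summing it over `𝔽₂^n`.
[folklore] -/
theorem sum_range_two_pow_eq_sum_testBit {M : Type*} [AddCommMonoid M] (n : ℕ) (G : (ℕ → Bool) → M)
    (hG : ∀ f g : ℕ → Bool, (∀ p, p < n → f p = g p) → G f = G g) :
    ∑ a ∈ range (2 ^ n), G (Nat.testBit a) = ∑ v : Fin n → Bool, G (wbit v) := by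
  induction n generalizing G with
  | zero =>
    rw [pow_zero, Finset.sum_range_one, Fintype.sum_unique]
    exact hG _ _ fun p hp => absurd hp (Nat.not_lt_zero p)
  | succ n ih =>
    -- split the cube along the last coordinate and the range into two halves
    rw [sum_snoc, pow_succ, mul_two, Finset.sum_range_add, Finset.sum_add_distrib]
    have hlow : ∀ c : Bool, ∑ v : Fin n → Bool, G (wbit (Fin.snoc v c : Fin (n + 1) → Bool)) =
        ∑ v : Fin n → Bool, G (fun p => if p = n then c else wbit v p) := fun c =>
      Finset.sum_congr rfl fun v _ => hG _ _ fun p _ => wbit_snoc v c p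
    rw [hlow, hlow]
    congr 1
    · rw [← ih (fun f => G (fun p => if p = n then false else f p))
        (fun f g h => hG _ _ fun p hp => by
          by_cases hpn : p = n
          · simp [hpn]
          · simp [hpn, h p (by omega)])]
      refine Finset.sum_congr rfl fun a ha => hG _ _ fun p hp => ?_
      by_cases hpn : p = n
      · subst hpn
        rw [if_pos rfl, Nat.testBit_lt_two_pow (Finset.mem_range.1 ha)]
      · rw [if_neg hpn]
    · rw [← ih (fun f => G (fun p => if p = n then true else f p))
        (fun f g h => hG _ _ fun p hp => by
          by_cases hpn : p = n
          · simp [hpn]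
          · simp [hpn, h p (by omega)])]
      refine Finset.sum_congr rfl fun a ha => hG _ _ fun p hp => ?_
      have ha' := Finset.mem_range.1 ha
      by_cases hpn : p = n
      · subst hpn
        rw [if_pos rfl, Nat.testBit_two_pow_add_eq, Nat.testBit_lt_two_pow ha']
        rfl
      · rw [if_neg hpn, Nat.testBit_two_pow_add_gt]
        omega

end Literature.Computability.QuantumComplexity.BravyiGosset

end
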